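import Summits.Ventures.HodgeRepro2.T5SU11ResolventL1GroundState
import Summits.Ventures.HodgeRepro2.T5SU11ResolventMonotoneDecay

/-!
# The constant `1/(λ − 1)²` is exact: the transform at the edge on `L¹(Ξ sinh 2t dt)` and the attained norms

Row 558 bounds the resolvent on `L¹(Ξ sinh 2t dt)` by `1/(λ − 1)²`, row 556 on the `Ξ`-weighted sup-norm space `W_1`. Both
constants are attained:

* `integrable_prod_kernel_mul_sph_one` — `K_λ(t, s) g(s) sinh 2s · Ξ(t) sinh 2t` is integrable on `(0, ∞)²` for every source
  of the class with `|g| Ξ sinh 2s ∈ L¹` (dominated by row 558's integrand);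
* `transform_greenSolI_one_of_integrable` — **`∫ (G^I_λ g) Ξ sinh 2t = −(∫ g Ξ sinh 2s)/(λ − 1)²`** — the ground-state
  transform of the resolvent for every source of the class in `L¹(Ξ sinh 2t dt)` (row 4xx's `transform_greenSolI_one_eq`
  needed the rate `ε > 1`);
* `integral_abs_greenSolI_mul_sph_one_eq_of_nonneg` — **for `g ≥ 0`, `∫ |G^I_λ g| Ξ sinh 2t = (∫ |g| Ξ sinh 2s)/(λ − 1)²`**:
  the `L¹(Ξ sinh 2t dt)` operator norm of `(L − μ)⁻¹` is EXACTLY `1/(λ − 1)²`;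
* `abs_greenSolI_sph_one_eq` — **`|G^I_λ Ξ(t)| = Ξ(t)/(λ − 1)²`**: the `W_1`-norm of `(L − μ)⁻¹` is exactly `1/(λ − 1)²`,
  attained on the ground state itself.

Nothing is claimed about (N).

Blind lane: Mathlib + the HodgeRepro2 prefix only; no sorry; axioms ⊆ {propext, Classical.choice,
Quot.sound}.
-/

namespace Summit.Ventures.HodgeRepro2.T5SU11ResolventGroundStateSharpness

open Filter Topology MeasureTheory
open Set (Ioi Ioc)
open T5SU11Cartan T5SU11SphericalFunction T5SU11SphericalDecay T5SU11RadialGreenKernel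
  T5SU11RadialGreenImproper T5SU11RadialGreenImproperDecaySource T5SU11ResolventKernelComposition
  T5SU11ResolventTransformClass T5SU11SphericalContinuous T5SU11SphericalBounds T5SU11ResolventEigenfunction
  T5SU11ResolventMonotoneDecay T5SU11ResolventGroundStateWeight T5SU11ResolventL1GroundState

section measure

variable [MeasurableSpace Circle] [BorelSpace Circle]

variable {lam : ℝ} (hlam : 1 < lam) {g : ℝ → ℝ} (hg : ContinuousOn g (Ioi 0))
  {M : ℝ} (hM : ∀ s ∈ Ioc (0 : ℝ) 1, |g s| ≤ M) (hM0 : 0 ≤ M)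
  {ε C s₀ : ℝ} (hε : 2 - lam < ε) (hC : ∀ s, s₀ ≤ s → |g s| ≤ C * Real.exp (-ε * s))
  (hg1 : IntegrableOn (fun s => |g s| * sph 1 (hyp s) * Real.sinh (2 * s)) (Ioi 0))

include hlam hg hg1 in
/-- **The product integrand `K_λ(t, s) g(s) sinh 2s · Ξ(t) sinh 2t` is integrable on `(0, ∞)²`** for every continuous source
with `|g| Ξ sinh 2s ∈ L¹(0, ∞)` (it is dominated by row 558's `|K_λ(t, s)| |g(s)| sinh 2s · Ξ(t) sinh 2t`). -/
theorem integrable_prod_kernel_mul_sph_one :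
    Integrable (Function.uncurry fun t s => sphGreenKernel lam t s * g s * Real.sinh (2 * s)
        * (sph 1 (hyp t) * Real.sinh (2 * t)))
      ((volume.restrict (Ioi 0)).prod (volume.restrict (Ioi 0))) := by
  have hχ : ContinuousOn (sphDecay lam) (Ioi 0) :=
    fun _ hr => (hasDerivAt_sphDecay hlam hr).continuousAt.continuousWithinAt
  have hdom := integrable_prod_kernel_abs_one hlam hg hg1
  rw [Measure.prod_restrict] at hdom ⊢
  have hmeas : AEStronglyMeasurable (Function.uncurry fun t s => sphGreenKernel lam t s * g s * Real.sinh (2 * s)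
      * (sph 1 (hyp t) * Real.sinh (2 * t))) ((volume.prod volume).restrict (Ioi 0 ×ˢ Ioi 0)) := by
    refine ContinuousOn.aestronglyMeasurable ?_ (measurableSet_Ioi.prod measurableSet_Ioi)
    have hK : ContinuousOn (fun p : ℝ × ℝ => sphGreenKernel lam p.1 p.2) (Ioi 0 ×ˢ Ioi 0) := by
      simp only [sphGreenKernel, greenKernel]
      apply ContinuousOn.neg
      apply ContinuousOn.mul
      · exact ((continuous_sph_hyp lam).comp (continuous_fst.min continuous_snd)).continuousOn
      · exact hχ.comp (continuous_fst.max continuous_snd).continuousOn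
          (fun p hp => Set.mem_Ioi.mpr (lt_of_lt_of_le (Set.mem_Ioi.mp hp.1) (le_max_left _ _)))
    have hg' : ContinuousOn (fun p : ℝ × ℝ => g p.2) (Ioi 0 ×ˢ Ioi 0) :=
      hg.comp continuous_snd.continuousOn (fun p hp => hp.2)
    exact ((hK.mul hg').mul (Real.continuous_sinh.comp (continuous_const.mul continuous_snd)).continuousOn).mul
      (((continuous_sph_hyp 1).comp continuous_fst).mul
        (Real.continuous_sinh.comp (continuous_const.mul continuous_fst))).continuousOn
  refine Integrable.mono' hdom hmeas ?_
  refine ae_restrict_of_forall_mem (measurableSet_Ioi.prod measurableSet_Ioi) (fun p hp => ?_)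
  obtain ⟨t, s⟩ := p
  have ht0 : 0 < t := hp.1
  have hs0 : 0 < s := hp.2
  have hsinh_t : 0 ≤ Real.sinh (2 * t) := Real.sinh_nonneg_iff.mpr (by linarith)
  have hsinh_s : 0 ≤ Real.sinh (2 * s) := Real.sinh_nonneg_iff.mpr (by linarith)
  simp only [Function.uncurry_apply_pair, Real.norm_eq_abs]
  rw [abs_mul, abs_mul, abs_mul, abs_mul, abs_of_nonneg hsinh_t, abs_of_nonneg hsinh_s,
    abs_of_pos (sph_hyp_pos 1 t)]
  exact le_of_eq (by ring)

include hlam hg hM hM0 hε hC hg1 in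
/-- **THE GROUND-STATE TRANSFORM OF THE RESOLVENT ON `L¹(Ξ sinh 2t dt)`**:
`∫_{(0,∞)} (G^I_λ g) Ξ sinh 2t dt = −(∫_{(0,∞)} g Ξ sinh 2s ds)/(λ − 1)²` for every source of the class with
`|g| Ξ sinh 2s ∈ L¹`. -/
theorem transform_greenSolI_one_of_integrable :
    ∫ t in Ioi 0, greenSolI (fun t => sph lam (hyp t)) (sphDecay lam) g t * sph 1 (hyp t) * Real.sinh (2 * t)
      = -(∫ s in Ioi 0, g s * sph 1 (hyp s) * Real.sinh (2 * s)) / (lam - 1) ^ 2 := by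
  have hF := integrable_prod_kernel_mul_sph_one hlam hg hg1
  have hswap := integral_integral_swap hF
  have hB := integrableOn_sph_mul_mul_sinh_Ioc hg hM hM0 lam
  have hA := integrableOn_sphDecay_mul_mul_sinh hlam hg hM hM0 hε hC
  obtain ⟨hΞ, ⟨Φ, hΦ0, hΦ⟩, hεΞ, CΞ, hCΞ⟩ := sph_one_class hlam
  have hB' := integrableOn_sph_mul_mul_sinh_Ioc hΞ hΦ hΦ0 lam
  have hA' := integrableOn_sphDecay_mul_mul_sinh hlam hΞ hΦ hΦ0 hεΞ (fun s hs => hCΞ s hs)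
  have hden : lam * (lam - 2) + 1 = (lam - 1) ^ 2 := by ring
  -- the left-hand side of Fubini is the transform of the resolvent
  have hL : ∫ t in Ioi 0, ∫ s in Ioi 0, sphGreenKernel lam t s * g s * Real.sinh (2 * s)
        * (sph 1 (hyp t) * Real.sinh (2 * t))
      = ∫ t in Ioi 0, greenSolI (fun t => sph lam (hyp t)) (sphDecay lam) g t * sph 1 (hyp t) * Real.sinh (2 * t) := by
    apply setIntegral_congr_fun measurableSet_Ioi
    intro t ht
    have ht0 : 0 < t := ht
    simp only
    rw [MeasureTheory.integral_mul_const, greenSolI_eq_integral_kernel hB hA ht0]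
    simp only [sphGreenKernel]
    ring
  -- the right-hand side is `∫_s g(s) sinh 2s · G^I_λ Ξ(s) = −∫ g Ξ sinh/(λ − 1)²`
  have hR : ∫ s in Ioi 0, ∫ t in Ioi 0, sphGreenKernel lam t s * g s * Real.sinh (2 * s)
        * (sph 1 (hyp t) * Real.sinh (2 * t))
      = ∫ s in Ioi 0, g s * Real.sinh (2 * s) * greenSolI (fun t => sph lam (hyp t)) (sphDecay lam)
          (fun s => sph 1 (hyp s)) s := by
    apply setIntegral_congr_fun measurableSet_Ioi
    intro s hs
    have hs0 : 0 < s := hs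
    simp only
    have e : ∀ t, sphGreenKernel lam t s * g s * Real.sinh (2 * s) * (sph 1 (hyp t) * Real.sinh (2 * t))
        = sphGreenKernel lam s t * sph 1 (hyp t) * Real.sinh (2 * t) * (g s * Real.sinh (2 * s)) := by
      intro t
      rw [sphGreenKernel_symm lam t s]
      ring
    simp only [e]
    rw [MeasureTheory.integral_mul_const]
    simp only [sphGreenKernel]
    rw [← greenSolI_eq_integral_kernel hB' hA' hs0]
    ring
  have hR' : ∫ s in Ioi 0, g s * Real.sinh (2 * s) * greenSolI (fun t => sph lam (hyp t)) (sphDecay lam)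
        (fun s => sph 1 (hyp s)) s
      = -(∫ s in Ioi 0, g s * sph 1 (hyp s) * Real.sinh (2 * s)) / (lam - 1) ^ 2 := by
    rw [neg_div, ← MeasureTheory.integral_div, ← MeasureTheory.integral_neg]
    apply setIntegral_congr_fun measurableSet_Ioi
    intro s hs
    have hs0 : 0 < s := hs
    simp only
    rw [greenSolI_sph_one_eq hlam hs0, hden]
    ring
  rw [← hL, hswap, hR, hR']

include hlam hg hM hM0 hε hC hg1 in
/-- **THE `L¹(Ξ sinh 2t dt)` NORM OF THE RESOLVENT IS EXACTLY `1/(λ − 1)²`**: for a non-negative source of the class in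
`L¹(Ξ sinh 2t dt)`, `∫ |G^I_λ g| Ξ sinh 2t = (∫ |g| Ξ sinh 2s)/(λ − 1)²` — row 558's bound is attained. -/
theorem integral_abs_greenSolI_mul_sph_one_eq_of_nonneg (hg0 : ∀ s, 0 < s → 0 ≤ g s) :
    ∫ t in Ioi 0, |greenSolI (fun t => sph lam (hyp t)) (sphDecay lam) g t| * sph 1 (hyp t) * Real.sinh (2 * t)
      = (∫ s in Ioi 0, |g s| * sph 1 (hyp s) * Real.sinh (2 * s)) / (lam - 1) ^ 2 := by
  have hT := transform_greenSolI_one_of_integrable hlam hg hM hM0 hε hC hg1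
  have e1 : ∫ t in Ioi 0, |greenSolI (fun t => sph lam (hyp t)) (sphDecay lam) g t| * sph 1 (hyp t) * Real.sinh (2 * t)
      = -∫ t in Ioi 0, greenSolI (fun t => sph lam (hyp t)) (sphDecay lam) g t * sph 1 (hyp t) * Real.sinh (2 * t) := by
    rw [← MeasureTheory.integral_neg]
    apply setIntegral_congr_fun measurableSet_Ioi
    intro t ht
    have ht0 : 0 < t := ht
    simp only
    rw [abs_of_nonpos (greenSolI_nonpos hlam hg0 ht0)]
    ring
  have e2 : ∫ s in Ioi 0, |g s| * sph 1 (hyp s) * Real.sinh (2 * s)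
      = ∫ s in Ioi 0, g s * sph 1 (hyp s) * Real.sinh (2 * s) := by
    apply setIntegral_congr_fun measurableSet_Ioi
    intro s hs
    simp only
    rw [abs_of_nonneg (hg0 s hs)]
  rw [e1, hT, e2]
  ring

include hlam in
/-- **The `W_1`-norm of the resolvent is exactly `1/(λ − 1)²`, attained on the ground state**:
`|G^I_λ Ξ(t)| = Ξ(t)/(λ − 1)²` for every `t > 0`. -/
theorem abs_greenSolI_sph_one_eq {t : ℝ} (ht : 0 < t) :
    |greenSolI (fun t => sph lam (hyp t)) (sphDecay lam) (fun s => sph 1 (hyp s)) t| = sph 1 (hyp t) / (lam - 1) ^ 2 := by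
  have hden : lam * (lam - 2) + 1 = (lam - 1) ^ 2 := by ring
  rw [greenSolI_sph_one_eq hlam ht, hden, abs_neg]
  exact abs_of_pos (div_pos (sph_hyp_pos 1 t) (by nlinarith))

end measure

end Summit.Ventures.HodgeRepro2.T5SU11ResolventGroundStateSharpness
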